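import Mathlib
import Summits.KontsevichZagierPeriods.Zeta5Search.FourthOrderFrame
import HarnessLib

/-!
# ζ(5) search — polynomial frame functionals: `p`-INTEGRALITY (tools for THEOREM L5, `SecondResidueLaw.LawA5`)

Cell `pub-zeta5` (HONEST FRAMING: systematic search; no irrationality claim unless certified), typer seat generation 13.
Companion of `FourthOrderFrame.lean`: for a short type (`L < p`, so that level differences are `p`-adic units) every
`ρ^T_{i,σ}` is `p`-integral (`padicNorm_typeRho_le_one`, via `coeffBound_binomSeries` for a unit base), and the frame functionals
`σ_T[G·Φ_T]` inherit the coefficient bound of `G`: `‖ŵ[GΦ_T]‖, ‖v̂[GΦ_T]‖ ≤ p^{−M}` whenever every coefficient of `G` has norm `≤ p^{−M}`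
(`padicNorm_frameWPoly_le`, `padicNorm_frameVPoly_le`).  `p`-adic norms of rational numbers; nothing here bears on irrationality.
-/

noncomputable section

open Finset PowerSeries

namespace Summit.KontsevichZagierPeriods.Zeta5Search.SecondOrder

open Summit.KontsevichZagierPeriods.Zeta5Search.ClusterValuation
open Summit.KontsevichZagierPeriods.Zeta5Search.PadicSeries
open Summit.KontsevichZagierPeriods.Zeta5Search.LevelClass (typeRho typeW typeV)
open Literature.NumberTheory.Transcendental.BallRivoal (harm)

variable {p : ℕ} [hp : Fact p.Prime]

/-! ## §4 `p`-integrality -/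

/-- A binomial series with a `p`-adic UNIT base is `p`-integral. -/
theorem coeffBound_binomSeries {δ : ℚ} (hδ : padicNorm p δ = 1) (ex : ℤ) : CoeffBound p 0 0 (binomSeries δ ex) := by
  intro k
  rw [coeff_binomSeries, padicNorm.mul, zero_mul, zero_sub, neg_zero, zpow_zero]
  have hδ0 : δ ≠ 0 := fun h => by rw [h, padicNorm.zero] at hδ; exact zero_ne_one hδ
  have hv : padicValRat p δ = 0 := by
    have h1 := hδ
    rw [padicNorm.eq_zpow_of_nonzero hδ0] at h1
    have h2 := (zpow_eq_one_iff_right₀ (show (0 : ℚ) ≤ p by positivity)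
      (by exact_mod_cast hp.out.ne_one : (p : ℚ) ≠ 1)).1 h1
    omega
  have h2 : padicNorm p (δ ^ (ex - k)) = 1 := by
    rw [padicNorm.eq_zpow_of_nonzero (zpow_ne_zero _ hδ0), padicValRat.zpow, hv, mul_zero, neg_zero, zpow_zero]
  have h3 : padicNorm p (Ring.choose (ex : ℚ) k) ≤ 1 := by
    have e1 : (Ring.choose (ex : ℚ) k) = ((Ring.choose ex k : ℤ) : ℚ) := by
      have := Ring.map_choose (Int.castRingHom ℚ) ex k
      simp only [eq_intCast] at this
      exact this.symm
    rw [e1]; exact padicNorm.of_int _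
  rw [h2, mul_one]
  exact h3

/-- An integer `d` with `0 < |d| < p` is a `p`-adic unit. -/
theorem padicNorm_int_eq_one_of_abs_lt {d : ℤ} (hd : d ≠ 0) (hlt : |d| < p) : padicNorm p (d : ℚ) = 1 := by
  rw [padicNorm.int_eq_one_iff]
  intro h
  have h1 := Int.le_of_dvd (abs_pos.2 hd) ((dvd_abs _ _).2 h)
  omega

/-- **Levels are units**: for `i, j ≤ L < p`, `i ≠ j`, `‖i − j‖_p = 1`. -/
theorem padicNorm_level_sub_eq_one {L i j : ℕ} (hL : L < p) (hi : i ≤ L) (hj : j ≤ L) (hij : i ≠ j) :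
    padicNorm p ((i : ℚ) - j) = 1 := by
  have e1 : ((i : ℚ) - j) = (((i : ℤ) - j : ℤ) : ℚ) := by push_cast; ring
  rw [e1]
  refine padicNorm_int_eq_one_of_abs_lt (by omega) ?_
  rw [abs_lt]; constructor <;> omega

/-- **The type product of a short type is `p`-integral** (`L < p`). -/
theorem coeffBound_typeProd {L : ℕ} (hL : L < p) (e : ℕ → ℤ) {i : ℕ} (hi : i ≤ L) :
    CoeffBound p 0 0 (typeProd L e i) := by
  unfold typeProd
  have h := CoeffBound.prod (p := p) (r := 0) ((range (L + 1)).erase i) (fun _ => (0 : ℤ))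
    (fun j => binomSeries ((i : ℚ) - j) (e j)) fun j hj => ?_
  · simpa using h
  · obtain ⟨hji, hjr⟩ := mem_erase.1 hj
    exact coeffBound_binomSeries (padicNorm_level_sub_eq_one hL hi (by have := mem_range.1 hjr; omega) (Ne.symm hji)) _

/-- **`‖ρ^T_{i,σ}‖_p ≤ 1`** for `L < p`, `i ≤ L`. -/
theorem padicNorm_typeRho_le_one {L : ℕ} (hL : L < p) (e : ℕ → ℤ) {i : ℕ} (hi : i ≤ L) (σ : ℕ) :
    padicNorm p (typeRho L e i σ) ≤ 1 := by
  rw [typeRho_eq]; exact (coeffBound_typeProd hL e hi).norm_le_one _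

/-- Sums preserve slope bounds. -/
theorem CoeffBound.add' {r M : ℤ} {F G : PowerSeries ℚ} (hF : CoeffBound p r M F) (hG : CoeffBound p r M G) :
    CoeffBound p r M (F + G) := fun k => by
  rw [map_add]; exact (padicNorm.nonarchimedean (p := p)).trans (max_le (hF k) (hG k))

/-- Finite sums preserve slope bounds. -/
theorem CoeffBound.sum' {ι : Type*} {r M : ℤ} (s : Finset ι) (F : ι → PowerSeries ℚ)
    (h : ∀ k ∈ s, CoeffBound p r M (F k)) : CoeffBound p r M (∑ k ∈ s, F k) := by
  classical
  induction s using Finset.induction_on with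
  | empty => intro k; rw [sum_empty, map_zero, padicNorm.zero]; exact zpow_p_nonneg _
  | insert a s ha ih =>
    rw [sum_insert ha]
    exact CoeffBound.add' (h a (mem_insert_self a s)) (ih fun k hk => h k (mem_insert_of_mem hk))

/-- **`G(i + ε)` inherits the coefficient bound of `G`.** -/
theorem coeffBound_polyAtLevel {M : ℤ} {G : Polynomial ℚ} (hG : ∀ k, padicNorm p (G.coeff k) ≤ (p : ℚ) ^ (-M)) (i : ℕ) :
    CoeffBound p 0 M (polyAtLevel G i) := by
  have hexp : polyAtLevel G i = ∑ k ∈ G.support, C (G.coeff k) * (X + C (i : ℚ)) ^ k := by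
    unfold polyAtLevel
    have h1 : G.comp (Polynomial.X + Polynomial.C (i : ℚ)) =
        ∑ k ∈ G.support, Polynomial.C (G.coeff k) * (Polynomial.X + Polynomial.C (i : ℚ)) ^ k := by
      conv_lhs => rw [G.as_sum_support_C_mul_X_pow]
      rw [Polynomial.sum_comp]
      refine sum_congr rfl fun k _ => ?_
      rw [Polynomial.mul_comp, Polynomial.C_comp, Polynomial.X_pow_comp]
    rw [h1, ← Polynomial.coeToPowerSeries.ringHom_apply, map_sum]
    refine sum_congr rfl fun k _ => ?_
    rw [Polynomial.coeToPowerSeries.ringHom_apply, Polynomial.coe_mul, Polynomial.coe_C, Polynomial.coe_pow,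
      Polynomial.coe_add, Polynomial.coe_X, Polynomial.coe_C]
  rw [hexp]
  refine CoeffBound.sum' _ _ fun k _ => ?_
  have hlin : CoeffBound p 0 0 (X + C (i : ℚ)) :=
    coeffBound_X_add_C le_rfl (by simpa using padicNorm.of_nat (p := p) i)
  have h := (coeffBound_C (r := 0) (hG k)).mul (hlin.pow k)
  simpa using h

/-- **`‖ρ[GΦ_T]_{i,σ}‖ ≤ p^{−M}`** when every coefficient of `G` has norm `≤ p^{−M}` (`L < p`, `i ≤ L`). -/
theorem padicNorm_frameRho_le {L : ℕ} (hL : L < p) (e : ℕ → ℤ) {M : ℤ} {G : Polynomial ℚ}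
    (hG : ∀ k, padicNorm p (G.coeff k) ≤ (p : ℚ) ^ (-M)) {i : ℕ} (hi : i ≤ L) (σ : ℕ) :
    padicNorm p (frameRho L e G i σ) ≤ (p : ℚ) ^ (-M) := by
  unfold frameRho
  split_ifs
  · have h := ((coeffBound_polyAtLevel hG i).mul (coeffBound_typeProd hL e hi)) ((-e i).toNat - σ)
    simpa using h
  · rw [padicNorm.zero]; exact zpow_p_nonneg _

/-- **`‖ŵ[GΦ_T]‖ ≤ p^{−M}`** under the same hypotheses. -/
theorem padicNorm_frameWPoly_le {L : ℕ} (hL : L < p) (e : ℕ → ℤ) {M : ℤ} {G : Polynomial ℚ}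
    (hG : ∀ k, padicNorm p (G.coeff k) ≤ (p : ℚ) ^ (-M)) : padicNorm p (frameWPoly L e G) ≤ (p : ℚ) ^ (-M) := by
  unfold frameWPoly
  refine padicNorm.sum_le' (fun i hi => ?_) (zpow_p_nonneg _)
  exact padicNorm_frameRho_le hL e hG (by have := mem_range.1 (mem_filter.1 hi).1; omega) 3

/-- **`‖v̂[GΦ_T]‖ ≤ p^{−M}`** under the same hypotheses (the harmonic numbers `H_i^{(σ)}`, `i < p`, are `p`-integral). -/
theorem padicNorm_frameVPoly_le {L : ℕ} (hL : L < p) (e : ℕ → ℤ) {M : ℤ} {G : Polynomial ℚ}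
    (hG : ∀ k, padicNorm p (G.coeff k) ≤ (p : ℚ) ^ (-M)) : padicNorm p (frameVPoly L e G) ≤ (p : ℚ) ^ (-M) := by
  unfold frameVPoly
  refine padicNorm.sum_le' (fun i hi => padicNorm.sum_le' (fun σ _ => ?_) (zpow_p_nonneg _)) (zpow_p_nonneg _)
  have hiL : i ≤ L := by have := mem_range.1 (mem_filter.1 hi).1; omega
  have h1 : padicNorm p ((-1 : ℚ) ^ σ) ≤ 1 := by
    have := padicNorm.of_int (p := p) ((-1) ^ σ); push_cast at this; exact this
  rw [padicNorm.mul, padicNorm.mul]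
  calc padicNorm p ((-1 : ℚ) ^ σ) * padicNorm p (frameRho L e G i σ) * padicNorm p (harm σ i)
      ≤ 1 * (p : ℚ) ^ (-M) * 1 := mul_le_mul (mul_le_mul h1 (padicNorm_frameRho_le hL e hG hiL σ)
          (padicNorm.nonneg _) zero_le_one)
        (BigPrime.padicNorm_harm_le_one σ i (by omega)) (padicNorm.nonneg _) (by positivity)
    _ = (p : ℚ) ^ (-M) := by ring

end Summit.KontsevichZagierPeriods.Zeta5Search.SecondOrder

end
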